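/-
Copyright (c) 2026 the pub-hodgecm-mathlib formalisation cell (harness21).  Prover seat hodgecm-mathlib-LH7-p10 (g2), req620 Track A «(D-RAM) FOUR-FRAME» squad
((β₂) road (R-36) «PURE-CELL LEDGER», lane C = type RamM; prequel of the lane-C twin of ★ p863007 `F0P3cDyRamBeta2ConesRowWindow` for LH4-p12 (g8)'s (OFF_C) dispatch knock 00:05:24Z), 2026-09-05.
-/
import Summits.HodgeConjecture.HodgeConjecture.Theorems.F0P3cDyRamFrameRamMLetters               -- ★ (LH4 lineage): `levelSet_eq_of_mul_sub_map_eq`, `levelSetDep_eq_of_twist` (change of generator); brings ★ DEFS `levelSet`, `IsOrd`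
import Summits.HodgeConjecture.HodgeConjecture.Theorems.F0P3cDyRamClassLettersRamM                -- ★ p858341: `exists_half_order_add`
import Summits.HodgeConjecture.HodgeConjecture.Theorems.F0P3cDyRamResidueFieldEvenCard           -- ★ (LH4-p06 (g5)): `two_dvd_natCard_residueField_of_v_two_lt_one`
import Summits.HodgeConjecture.HodgeConjecture.Theorems.F0P3cDyRamFourFramePieces                 -- ★ DEFS: the block element spelling `GL (Fin 1) E` of `u`
import HarnessLib

/-!
# Crux `H413`, line LH4 «(D-RAM) FOUR-FRAME» — (β₂) road, lane C (type RamM, `|α − ρα| < 1`): «THE LANE-C BRIDGE OF THE RamM CONE LEDGER» — the frame letters of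
# ‹OFF_C.letter.v2› ↦ the letters of the ★ RamM tables: `|jE ϖ| = exp(−2)`, `2 ∣ #𝓀[M]`, the cone scalar's half-order, the change of generator `α ↦ ϖM`, the unit bridge
# `m = 2m_E`, `jl = 2jl_E + d_ρ`, `m_E ≤ jl_E`, and (W0)_C `lam ∈ 𝒪_j ⟺ 2j + d_ρ ≤ jl`

Cell `hodgecm-mathlib` (D-0151), FLOOR 0, crux item H413 = `stmt-HodgeConjecture-24833`, route of record `HCCMUnconditional`; squads F0∕P3c∕LH4 + LH7; lane
`--supports stmt-HodgeConjecture-24833 --as helper` (count-neutral; pays NO tier-0 row).  THEOREMS ONLY (no `def`, no instance, no notation, no `sorry`, default heartbeats);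
★-only imports; states NO law; NO CM token, NO datum value: one abstract pair of complete discretely valued fields `E → M`.

CURRENCY.  The binders of every theorem are a SUBSET, BY TYPE, of ‹OFF_C.letter.v2› (a2c0234d7b04450d; `F0/P3c/LH7/LH7-p10/g2/OFF_C.letter.v2.LH7p10g2.lean.txt`) = β₂
sub-dealer LH4-p04 (g9)'s ‹OFF.letter.v1› with the lane-C block `_hC, _c1 … _c29` (★ p862186's RamM place package) for the type-B letters; here `cN` names the letter `_cN`
(`c1 : |jE a| = |a|²`, `c5 : |ϖM| = exp(−1)`, `c6 : α − ρα = ϖM − ρϖM`, `c7`∕`c8 : the ρ∕Θ ramified data at ϖM`, `c12 c13 : c₀`, `c14 : hFN`, `c15–c17 : n₀`, `c19 : hF4`,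
`c21 : dΘ = 2g`, `c22 : dτ = 2s0`, `c23 : 1 ≤ g`, `c24 : 1 ≤ s0`, `c28`∕`c29 : the Klein letter 2d′ = d_ρ + dτ`), and `X(j, b)` IS ‹OFF_C›'s two-finsum difference VERBATIM
(= ‹OFF›'s: the lane-C substitution touches binders only).  So LH4-p12 (g8)'s ED. 1-C dispatch `cellDiff_offRowC_eq_zero_of_pieces` applies each zero BY NAME to the letter's
own hypotheses.

WHAT IS PROVED (letters-to-letters plumbing; no lattice is counted here):
* §0 `v_map_varpi_eq` (`|jE ϖ| = exp(−2)` from `c1`, `|ϖ| = exp(−1)`), `two_dvd_natCard_residueField_ramM` (`2 ∣ #𝓀[M]` from `¬ IsUnit (2 : 𝒪[E])` and `c2`, ★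
  `two_dvd_natCard_residueField_of_v_two_lt_one`), `exists_order_half_order` (the cone scalar's `|h| = exp(−v_h)`, `v_h + d_ρ = 2e`, ★ `exists_half_order_add`), the change of
  generator `levelSet_eq_levelSet_varpiM` ∕ `levelSetDep_eq_levelSetDep_varpiM` (★ `levelSet_eq_of_mul_sub_map_eq` ∕ ★ `levelSetDep_eq_of_twist` at `e = 1`: `c6 : α − ρα = ϖM − ρϖM`
  makes it a rewrite), and THE UNIT BRIDGE: `exists_jl_eq_two_mul_add` (`jl = 2jl_E + d_ρ`: `(μ − ρμ)∕(α − ρα)` is ρ-fixed, non-zero and integral), `v_mu_eq_pow`, `v_mu_sub_eq_mul`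
  (the letter's v_M tokens `|μ| = exp(−m)`, `|μ − ρμ| = exp(−jl)` ↦ the readers' `|μ| = |ϖE|^{m_E}`, `|μ − ρμ| = |ϖE^{jl_E}(ϖM − ρϖM)|` for `m = 2m_E`), `half_m_le_half_jl` (`m_E ≤ jl_E`,
  by `_hint` at the unit `μ∕ϖE^{m_E}`).
* §1 (W0)_C `isOrd_lam_iff_le_ramM : IsOrd ρ α (jE ϖ ^ j) lam ↔ 2j + d_ρ ≤ jl` (`|jE ϖ^j·(α − ρα)| = exp(−(2j + d_ρ))`); with `jl = 2jl_E + d_ρ` this is `j ≤ jl_E`; `m ≤ jl` is ★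
  p863007 `m_le_jl` verbatim.
Sequel (the window proper, `X(j,b) = 0` on the empty cells of the ★ RamM atlas): `F0P3cDyRamBeta2ConesRowWindowC`.
HONEST LABEL.  Count-neutral index ∕ lattice bookkeeping over ★ tables; nothing printed is asserted; no census law is stated; ‹OFF_C›, ‹ROW_C›, (β₂) stay HYPOTHESES; `HC_CM` is
proved only modulo the 7 printed citations (2 remaining named inputs: hLiu418 = `stmt-HodgeConjecture-24832`, h413 = `stmt-HodgeConjecture-24833`) until rung 0 closes.
## References
* [Kottwitz1986BaseChangeUnits] R. E. Kottwitz, *Base change for unit elements of Hecke algebras*, Compositio Math. 60 (1986), §1 pp. 240–241 (cell-by-cell lattice counts).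
* [Flicker1998UnitaryFL] Y. Z. Flicker, *Elementary proof of the fundamental lemma for a unitary group*, Canad. J. Math. 50 (1998), Prop. 7 p. 84.
* [Jacobowitz1962] R. Jacobowitz, *Hermitian forms over local fields*, Amer. J. Math. 84 (1962), §4.
* [Serre1979] J.-P. Serre, *Local Fields*, GTM 67 (1979), Ch. III §6 Prop. 12; Ch. IV §1 Prop. 3–4; Ch. V §3 Prop. 5, Cor. 2–3 pp. 84–86.
-/

set_option autoImplicit false

noncomputable section

namespace Summit.HodgeConjecture.HodgeConjecture.Cruxes.H413.F0P3cDyRamBeta2ConesRowWindowCBridge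

open scoped Matrix MatrixGroups Classical Valued WithZero
open WithZero
open Literature.NumberTheory.Automorphic Literature.NumberTheory.Automorphic.UnitaryThreeFourFrame
open Summit.HodgeConjecture.HodgeConjecture.Cruxes.H413.F0P3cDyRamToricCensusDefs
open Summit.HodgeConjecture.HodgeConjecture.Cruxes.H413.F0P3cDyRamClassLettersRamM (exists_half_order_add)
open Summit.HodgeConjecture.HodgeConjecture.Cruxes.H413.F0P3cDyRamFrameRamMLetters (levelSet_eq_of_mul_sub_map_eq levelSetDep_eq_of_twist)
open Summit.HodgeConjecture.HodgeConjecture.Cruxes.H413.F0P3cDyRamToricLevelCensusRamM (two_dvd_natCard_residueField_of_v_two_lt_one)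
open Summit.HodgeConjecture.HodgeConjecture.Cruxes.H413

variable {E M : Type} [Field E] [Valued E ℤᵐ⁰] [Field M] [Valued M ℤᵐ⁰]
  {σ : E →+* E} {ϖ : E} {d tE : ℕ} {jE : E →+* M} {ρ Θ : M →+* M} {α lam : M} {u : GL (Fin 1) E} {m jl : ℕ}
  {h : M} {ϖM c₀ n₀ : M} {dρ dΘ dτ g s0 d' : ℕ}

/-! ## §0 The lane-C plumbing: frame letters ↦ the ★ RamM table letters, change of generator, the unit bridge -/

/-- `|jE ϖ| = exp(−2)`: the E-uniformiser read in `M` (`c1 : |jE a| = |a|²`, `|ϖ| = exp(−1)`). [cite: Serre1979, Ch. III §6 Prop. 12] -/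
theorem v_map_varpi_eq (hD : IsRamifiedQuadraticDatum σ ϖ d tE) (c1 : ∀ a, Valued.v (jE a) = Valued.v a ^ 2) : Valued.v (jE ϖ) = WithZero.exp (-2 : ℤ) := by
  rw [c1, hD.2.2.1, ← exp_nsmul]; congr 1

/-- **`2 ∣ #𝓀[M]`** at a dyadic place: `¬ IsUnit (2 : 𝒪[E])` puts `2` in `𝓂_E`, so `#𝓀[E]` is even (★ `two_dvd_natCard_residueField_of_v_two_lt_one`), and `#𝓀[M] = #𝓀[E]` (`c2`, `M ∕ E`
totally ramified). [cite: Serre1979, Ch. III §6 Prop. 12] -/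
theorem two_dvd_natCard_residueField_ramM [Finite 𝓀[E]] (h2 : ¬ IsUnit (2 : 𝒪[E])) (c2 : Nat.card 𝓀[M] = Nat.card 𝓀[E]) : 2 ∣ Nat.card 𝓀[M] := by
  have h2v : Valued.v (2 : E) < 1 := by
    by_contra hv
    apply h2
    have hc : ((2 : 𝒪[E]) : E) = 2 := by norm_cast
    have hle : Valued.v ((2 : 𝒪[E]) : E) ≤ 1 := (2 : 𝒪[E]).2
    have h1 : Valued.v ((2 : 𝒪[E]) : E) = 1 := le_antisymm hle (by rw [hc]; exact not_lt.mp hv)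
    have hu : IsUnit ((2 : 𝒪[E]) : E) := by
      rw [isUnit_iff_ne_zero]
      intro h0
      rw [h0, map_zero] at h1
      exact zero_ne_one h1
    exact Valuation.Integers.isUnit_of_one (Valuation.integer.integers (Valued.v : Valuation E ℤᵐ⁰)) hu h1
  rw [c2]; exact two_dvd_natCard_residueField_of_v_two_lt_one h2v rfl

/-- **THE ORDER AND HALF-ORDER OF THE CONE SCALAR**: `|h| = exp(−v_h)` and `v_h + d_ρ = 2e` for some `v_h, e ∈ ℤ` — `h` is Θ-fixed non-zero, so `v_h` is even (`c8`: Θ-fixed elements have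
even order), and `d_ρ = 2d′ − dτ = 2d′ − 2s0` is even (`c29`, `c22`) (★ `exists_half_order_add`). [cite: Serre1979, Ch. III §6 Prop. 12] -/
theorem exists_order_half_order (c8 : IsRamifiedQuadraticDatum Θ ϖM dΘ (2 * tE)) (c22 : dτ = 2 * s0) (c29 : 2 * d' = dρ + dτ) (hΘh : Θ h = h) (hh : h ≠ 0) :
    ∃ vh e : ℤ, Valued.v h = WithZero.exp (-vh) ∧ vh + dρ = 2 * e := by
  have hvh : Valued.v h = exp (-(-log (Valued.v h))) := by rw [neg_neg, exp_log ((Valuation.ne_zero_iff _).2 hh)]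
  have hds : 2 * d' = dρ + 2 * s0 := by omega
  obtain ⟨e, he⟩ := exists_half_order_add c8.2.2.2.1 hΘh hh hvh hds
  exact ⟨_, e, hvh, he⟩

/-- **CHANGE OF GENERATOR, u-free cells**: `c6 : α − ρα = ϖM − ρϖM` gives `levelSet ρ Θ α c h j b = levelSet ρ Θ ϖM c h j b` (★ `levelSet_eq_of_mul_sub_map_eq`; `IsOrd` and `dualGen` read `α`
only through `α − ρα`). [cite: Jacobowitz1962, §4] [cite: Kottwitz1986BaseChangeUnits, §1 pp. 240–241] -/
theorem levelSet_eq_levelSet_varpiM (c6 : α - ρ α = ϖM - ρ ϖM) (c : M) (j b : ℕ) : levelSet ρ Θ α c h j b = levelSet ρ Θ ϖM c h j b :=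
  levelSet_eq_of_mul_sub_map_eq (by rw [c6]) (by rw [c6]) c j b

/-- **CHANGE OF GENERATOR, cone cells**: `levelSetDep ρ Θ α c h j b μ = levelSetDep ρ Θ ϖM c h j b μ` (★ `levelSetDep_eq_of_twist` with the trivial twist `e = 1`).
[cite: Jacobowitz1962, §4] [cite: Kottwitz1986BaseChangeUnits, §1 pp. 240–241] -/
theorem levelSetDep_eq_levelSetDep_varpiM (c6 : α - ρ α = ϖM - ρ ϖM) (c : M) (j b : ℕ) (μ : M) : levelSetDep ρ Θ α c h j b μ = levelSetDep ρ Θ ϖM c h j b μ :=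
  levelSetDep_eq_of_twist (e := 1) (map_one ρ) (map_one _) (mul_one h).symm (by rw [one_mul]; exact c6) c j b μ

omit [Valued E ℤᵐ⁰] in
/-- **THE UNIT BRIDGE, (i) `jl = 2jl_E + d_ρ`**: `x := (μ − ρμ)∕(α − ρα)` is `ρ`-FIXED, non-zero (`|μ − ρμ| = exp(−jl) ≠ 0`) and INTEGRAL (`_hint` at `z = μ`, `|μ| = exp(−m) ≤ 1`), so
`|x| = exp(2n)` with `n ≤ 0` (`c7`: ρ-fixed elements have even order) and `exp(−jl) = |x|·|α − ρα| = exp(2n − d_ρ)`. [cite: Serre1979, Ch. III §6 Prop. 12] [cite: Serre1979, Ch. IV §1 Prop. 3–4] -/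
theorem exists_jl_eq_two_mul_add (c5 : Valued.v ϖM = WithZero.exp (-1 : ℤ)) (c6 : α - ρ α = ϖM - ρ ϖM) (c7 : IsRamifiedQuadraticDatum ρ ϖM dρ (2 * tE))
    (hint : ∀ z : M, Valued.v z ≤ 1 → Valued.v ((z - ρ z) / (α - ρ α)) ≤ 1)
    (hm : Valued.v (lam - jE ((u : Matrix (Fin 1) (Fin 1) E) 0 0)) = WithZero.exp (-(m : ℤ)))
    (hjl : Valued.v ((lam - jE ((u : Matrix (Fin 1) (Fin 1) E) 0 0)) - ρ (lam - jE ((u : Matrix (Fin 1) (Fin 1) E) 0 0))) = WithZero.exp (-(jl : ℤ))) :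
    ∃ jlE : ℕ, jl = 2 * jlE + dρ := by
  have hαρ : Valued.v (α - ρ α) = exp (-(dρ : ℤ)) := by rw [c6, c7.2.2.2.2.1, c5, ← exp_nsmul]; simp
  have hα0 : α - ρ α ≠ 0 := fun h0 => by rw [h0, map_zero] at hαρ; exact zero_ne_coe hαρ
  have hμ1 : Valued.v (lam - jE ((u : Matrix (Fin 1) (Fin 1) E) 0 0)) ≤ 1 := by rw [hm, ← exp_zero, exp_le_exp]; omega
  have hx0 : (lam - jE ((u : Matrix (Fin 1) (Fin 1) E) 0 0)) - ρ (lam - jE ((u : Matrix (Fin 1) (Fin 1) E) 0 0)) ≠ 0 := fun h0 => by rw [h0, map_zero] at hjl; exact zero_ne_coe hjl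
  have key : ∀ w : M, ρ ((w - ρ w) / (α - ρ α)) = (w - ρ w) / (α - ρ α) := fun w => by
    rw [map_div₀, map_sub, map_sub, c7.1, c7.1, ← neg_sub w, ← neg_sub α, neg_div_neg_eq]
  obtain ⟨n, hn⟩ := c7.2.2.2.1 _ (key (lam - jE ((u : Matrix (Fin 1) (Fin 1) E) 0 0))) (div_ne_zero hx0 hα0)
  have hle : Valued.v (((lam - jE ((u : Matrix (Fin 1) (Fin 1) E) 0 0)) - ρ (lam - jE ((u : Matrix (Fin 1) (Fin 1) E) 0 0))) / (α - ρ α)) ≤ 1 := hint _ hμ1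
  have hn0 : n ≤ 0 := by rw [hn, ← exp_zero, exp_le_exp] at hle; omega
  have hprod : Valued.v ((lam - jE ((u : Matrix (Fin 1) (Fin 1) E) 0 0)) - ρ (lam - jE ((u : Matrix (Fin 1) (Fin 1) E) 0 0))) = Valued.v (((lam - jE ((u : Matrix (Fin 1) (Fin 1) E) 0 0)) - ρ (lam - jE ((u : Matrix (Fin 1) (Fin 1) E) 0 0))) / (α - ρ α)) * Valued.v (α - ρ α) := by
    rw [← map_mul, div_mul_cancel₀ _ hα0]
  rw [hjl, hn, hαρ, ← exp_add] at hprod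
  have hinj := exp_injective hprod
  exact ⟨(-n).toNat, by omega⟩

/-- **THE UNIT BRIDGE, (ii)**: for `m = 2m_E`, `|μ| = exp(−m) = |jE ϖ|^{m_E}`. [cite: Serre1979, Ch. III §6 Prop. 12] -/
theorem v_mu_eq_pow (hD : IsRamifiedQuadraticDatum σ ϖ d tE) (c1 : ∀ a, Valued.v (jE a) = Valued.v a ^ 2)
    (hm : Valued.v (lam - jE ((u : Matrix (Fin 1) (Fin 1) E) 0 0)) = WithZero.exp (-(m : ℤ))) {mE : ℕ} (hmE : m = 2 * mE) :
    Valued.v (lam - jE ((u : Matrix (Fin 1) (Fin 1) E) 0 0)) = Valued.v (jE ϖ) ^ mE := by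
  rw [hm, v_map_varpi_eq hD c1, ← exp_nsmul, hmE]; congr 1; simp only [nsmul_eq_mul]; push_cast; ring

/-- **THE UNIT BRIDGE, (iii)**: for `jl = 2jl_E + d_ρ`, `|μ − ρμ| = exp(−jl) = |jE ϖ^{jl_E}·(ϖM − ρϖM)|` (`|ϖM − ρϖM| = |ϖM|^{d_ρ}`, `c7`). [cite: Serre1979, Ch. III §6 Prop. 12] -/
theorem v_mu_sub_eq_mul (hD : IsRamifiedQuadraticDatum σ ϖ d tE) (c1 : ∀ a, Valued.v (jE a) = Valued.v a ^ 2) (c5 : Valued.v ϖM = WithZero.exp (-1 : ℤ))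
    (c7 : IsRamifiedQuadraticDatum ρ ϖM dρ (2 * tE))
    (hjl : Valued.v ((lam - jE ((u : Matrix (Fin 1) (Fin 1) E) 0 0)) - ρ (lam - jE ((u : Matrix (Fin 1) (Fin 1) E) 0 0))) = WithZero.exp (-(jl : ℤ))) {jlE : ℕ} (hjlE : jl = 2 * jlE + dρ) :
    Valued.v ((lam - jE ((u : Matrix (Fin 1) (Fin 1) E) 0 0)) - ρ (lam - jE ((u : Matrix (Fin 1) (Fin 1) E) 0 0))) = Valued.v (jE ϖ ^ jlE * (ϖM - ρ ϖM)) := by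
  rw [hjl, map_mul, map_pow, v_map_varpi_eq hD c1, c7.2.2.2.2.1, c5, ← exp_nsmul, ← exp_nsmul, ← exp_add, hjlE]
  congr 1; simp only [nsmul_eq_mul]; push_cast; ring

/-- **THE UNIT BRIDGE, (iv) `m_E ≤ jl_E`**: `z := μ∕(jE ϖ)^{m_E}` is a unit, so `_hint` at `z` reads `|(μ − ρμ)∕(α − ρα)|·|jE ϖ|^{−m_E} ≤ 1`, i.e. `exp(2m_E − 2jl_E) ≤ 1` (`ρ` fixes `jE ϖ`).
[cite: Serre1979, Ch. III §6 Prop. 12] [cite: Serre1979, Ch. IV §1 Prop. 3–4] -/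
theorem half_m_le_half_jl (hD : IsRamifiedQuadraticDatum σ ϖ d tE) (hρj : ∀ a, ρ (jE a) = jE a) (c1 : ∀ a, Valued.v (jE a) = Valued.v a ^ 2)
    (c5 : Valued.v ϖM = WithZero.exp (-1 : ℤ)) (c6 : α - ρ α = ϖM - ρ ϖM) (c7 : IsRamifiedQuadraticDatum ρ ϖM dρ (2 * tE))
    (hint : ∀ z : M, Valued.v z ≤ 1 → Valued.v ((z - ρ z) / (α - ρ α)) ≤ 1)
    (hm : Valued.v (lam - jE ((u : Matrix (Fin 1) (Fin 1) E) 0 0)) = WithZero.exp (-(m : ℤ)))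
    (hjl : Valued.v ((lam - jE ((u : Matrix (Fin 1) (Fin 1) E) 0 0)) - ρ (lam - jE ((u : Matrix (Fin 1) (Fin 1) E) 0 0))) = WithZero.exp (-(jl : ℤ))) {mE jlE : ℕ} (hmE : m = 2 * mE) (hjlE : jl = 2 * jlE + dρ) :
    mE ≤ jlE := by
  have hϖE : Valued.v (jE ϖ) = exp (-2 : ℤ) := v_map_varpi_eq hD c1
  have hϖE0 : jE ϖ ^ mE ≠ 0 := pow_ne_zero _ fun h0 => by rw [h0, map_zero] at hϖE; exact zero_ne_coe hϖE
  have hαρ : Valued.v (α - ρ α) = exp (-(dρ : ℤ)) := by rw [c6, c7.2.2.2.2.1, c5, ← exp_nsmul]; simp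
  have hz1 : Valued.v ((lam - jE ((u : Matrix (Fin 1) (Fin 1) E) 0 0)) / jE ϖ ^ mE) ≤ 1 := by
    rw [map_div₀, map_pow, hm, hϖE, ← exp_nsmul, ← exp_sub, ← exp_zero, exp_le_exp, hmE]; simp only [nsmul_eq_mul]; push_cast; omega
  have hle := hint _ hz1
  have e : (lam - jE ((u : Matrix (Fin 1) (Fin 1) E) 0 0)) / jE ϖ ^ mE - ρ ((lam - jE ((u : Matrix (Fin 1) (Fin 1) E) 0 0)) / jE ϖ ^ mE) = ((lam - jE ((u : Matrix (Fin 1) (Fin 1) E) 0 0)) - ρ (lam - jE ((u : Matrix (Fin 1) (Fin 1) E) 0 0))) / jE ϖ ^ mE := by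
    rw [map_div₀, map_pow, hρj, div_sub_div_same]
  rw [e, map_div₀, map_div₀, map_pow, hjl, hαρ, hϖE, ← exp_nsmul, ← exp_sub, ← exp_sub, ← exp_zero, exp_le_exp, hjlE] at hle
  simp only [nsmul_eq_mul, Nat.cast_add, Nat.cast_mul, Nat.cast_ofNat] at hle
  omega

/-! ## §1 (W0)_C `lam ∈ 𝒪_j ⟺ 2j + d_ρ ≤ jl` -/

/-- **(W0)_C THE ORDER LEVELS OF `lam` IN THE RamM LANE ARE `2j + d_ρ ≤ jl`**: `IsOrd ρ α (jE ϖ^j) lam ↔ 2j + d_ρ ≤ jl` (`|jE ϖ^j·(α − ρα)| = exp(−(2j + d_ρ))` by `c1`, `c6`, `c7`, `c5`;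
`lam − ρ lam = μ − ρμ` since `ρ` fixes `jE u₀₀`).  With `jl = 2jl_E + d_ρ` (§0) this is `j ≤ jl_E`; `m ≤ jl` is ★ p863007 `m_le_jl` verbatim. [cite: Serre1979, Ch. III §6 Prop. 12]
[cite: Kottwitz1986BaseChangeUnits, §1 pp. 240–241] -/
theorem isOrd_lam_iff_le_ramM (hD : IsRamifiedQuadraticDatum σ ϖ d tE) (hρj : ∀ a, ρ (jE a) = jE a) (hvlam : Valued.v lam = 1)
    (c1 : ∀ a, Valued.v (jE a) = Valued.v a ^ 2) (c5 : Valued.v ϖM = WithZero.exp (-1 : ℤ)) (c6 : α - ρ α = ϖM - ρ ϖM) (c7 : IsRamifiedQuadraticDatum ρ ϖM dρ (2 * tE))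
    (hjl : Valued.v ((lam - jE ((u : Matrix (Fin 1) (Fin 1) E) 0 0)) - ρ (lam - jE ((u : Matrix (Fin 1) (Fin 1) E) 0 0))) = WithZero.exp (-(jl : ℤ))) (j : ℕ) :
    IsOrd ρ α (jE ϖ ^ j) lam ↔ 2 * j + dρ ≤ jl := by
  have hϖE : Valued.v (jE ϖ) = exp (-2 : ℤ) := v_map_varpi_eq hD c1
  have hαρ : Valued.v (α - ρ α) = exp (-(dρ : ℤ)) := by rw [c6, c7.2.2.2.2.1, c5, ← exp_nsmul]; simp
  have e : (lam - jE ((u : Matrix (Fin 1) (Fin 1) E) 0 0)) - ρ (lam - jE ((u : Matrix (Fin 1) (Fin 1) E) 0 0)) = lam - ρ lam := by rw [map_sub, hρj]; ring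
  rw [isOrd_iff, ← e, hjl, Valuation.map_mul, hαρ, Valuation.map_pow, hϖE, ← exp_nsmul, ← exp_add, exp_le_exp]
  simp only [nsmul_eq_mul]
  constructor
  · rintro ⟨-, hle⟩; omega
  · intro hle; exact ⟨hvlam.le, by omega⟩

end Summit.HodgeConjecture.HodgeConjecture.Cruxes.H413.F0P3cDyRamBeta2ConesRowWindowCBridge

end
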